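import Summits.AtomisticToContinuum.FouriersLaw.Theorems.OddSectorIrreversibilitySubBallisticWindowTimeAveragedCorrector
import Summits.AtomisticToContinuum.FouriersLaw.Theorems.OddSectorIrreversibilitySubBallisticWindowPartial

/-!
# `SubBallisticWindow` (stmt-AtomisticToContinuum-14070), line `Sketch`: the corrector family is E2-EQUIVALENT, part 2

Support file for crux `Summit.AtomisticToContinuum.FouriersLaw.Theses.OddSectorIrreversibility.SubBallisticWindow`
(E2 of route OddSectorIrreversibility). The line `Sketch` (coboundary–Thomson ceiling) reduces E2 to the
registered stub `stub_correctorFamily` (`…SubBallisticWindow.Partial.subBallisticWindow_of_correctorFamily`): for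
every block `B = [k₁,k₂)` (`ℓ = k₂ - k₁ ≥ 2`) and window `τ ≥ 1` SOME test observable `G ∈ C²` achieves
`8 ∫ (G - c)² dμ_T + 2 τ² ∫ (J_B - {H,G})² dμ_T ≤ C (1+τ) ℓ Z`. This file proves the CONVERSE, so the open stub is
exactly crux-equivalent:

* §4 `poisson_tent` — for the tent integral `G̃_τ(x) = ∫₀^τ (τ - σ) J_B(Φ_σ x) dσ` (smooth by part 1),
  `{H, G̃_τ} = Q_B(τ) - τ J_B` EXACTLY: by the flow property `G̃_τ(Φ_r x) = ∫_r^{τ+r} (τ + r - u) J_B(Φ_u x) du`, whose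
  derivative at `r = 0⁺` is `∫₀^τ J_B∘Φ_u du - τ J_B` (part 1), while the chain rule gives `DG̃_τ·X_H = {H, G̃_τ}`;
* §5 `correctorFamily_of_windowBound` — **E2 ⇒ corrector family**: given `V_B(t) = ∫ Q_B(t)² dμ_T ≤ C (1+t) ℓ Z`, the
  time-averaged coboundary corrector `G_τ = -(1/τ) G̃_τ = -(1/τ) ∫₀^τ Q_B(t) dt` satisfies `{H,G_τ} = J_B - Q_B(τ)/τ`,
  `∫ G_τ² dμ_T ≤ (1/τ) ∫₀^τ V_B ≤ C (1+τ) ℓ Z` (Jensen + Tonelli, part 1), hence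
  `8 ∫ G_τ² + 2 τ² ∫ (J_B - {H,G_τ})² ≤ 10 C (1+τ) ℓ Z`;
* §6 `correctorFamily_of_subBallisticWindow` (registered sub-goal, crux vocabulary) — E2 read through the Dirac
  dictionary implies `stub_correctorFamily` verbatim, constant `10 · max C 0`;
* §7 `subBallisticWindow_iff_correctorFamily` — **the crux E2, an `N`-uniform DYNAMICAL statement about the closed
  Hamiltonian flow, is equivalent to a purely STATIC variational statement** (only `μ_T`-integrals of `G`, `{H,G}`,
  `J_B` occur): what remains open in the line is E2 itself, in Thomson form.

Nothing here closes the item.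
-/

noncomputable section

namespace Summit.AtomisticToContinuum.FouriersLaw.Theorems.SubBallisticWindow.CorrectorEquivalence

open MeasureTheory Filter Topology Set
open scoped NNReal ENNReal ContDiff
open Literature.MathematicalPhysics.KineticTheory.HeatConduction
open Summit.AtomisticToContinuum.FouriersLaw.Theorems.ClosedConeSensitivity.Negative.ZeroFrictionDictionary
open Summit.AtomisticToContinuum.FouriersLaw.Theorems.OddSectorWitness
open Summit.AtomisticToContinuum.FouriersLaw.Theorems.SubBallisticWindow.TimeAveragedCorrector
open Summit.AtomisticToContinuum.FouriersLaw.Theses.OddSectorIrreversibility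

section Flow

variable {ω₂ lam β : ℝ} (hω : 0 < ω₂) (hl : 0 ≤ lam) (hβ : 0 ≤ β)
include hω hl hβ

/-! ## §4 The tent integral: smoothness and its Poisson bracket with `H` -/

omit hω hl hβ in
/-- The bond currents of the pinned chain are smooth. (adapted from `CorrectorTheorySmooth.contDiff_bondCurrent`)
[folklore] -/
theorem contDiff_bondCurrent (γ : ℝ) (N : ℕ) (i : Fin N) :
    ContDiff ℝ ∞ fun x : PhaseSpace N => (pinnedChain ω₂ lam β γ).bondCurrent N i x := by
  have hV : ContDiff ℝ ∞ (pinnedChain ω₂ lam β γ).V := pinnedChain_contDiff_V ω₂ lam β γ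
  have hV' : ContDiff ℝ ∞ (deriv (pinnedChain ω₂ lam β γ).V) := (contDiff_infty_iff_deriv.1 hV).2
  unfold OscillatorChain.bondCurrent
  refine ContDiff.sum fun j _ => ?_
  split_ifs
  · exact (((((contDiff_apply ℝ ℝ i).comp contDiff_snd).add ((contDiff_apply ℝ ℝ j).comp contDiff_snd)).div_const
      2).mul (hV'.comp (((contDiff_apply ℝ ℝ j).comp contDiff_fst).sub
        ((contDiff_apply ℝ ℝ i).comp contDiff_fst)))).neg
  · exact contDiff_const

omit hω hl hβ in
/-- The block current is smooth. [folklore] -/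
theorem contDiff_blockCurrent (γ : ℝ) (N k₁ k₂ : ℕ) : ContDiff ℝ ∞ (blockCurrent ω₂ lam β γ N k₁ k₂) := by
  unfold blockCurrent
  refine ContDiff.sum fun i _ => ?_
  split_ifs
  · exact contDiff_bondCurrent γ N i
  · exact contDiff_const

omit hω hl hβ in
/-- The tent integrand `(σ, z) ↦ (τ - σ) J_B(z)` is smooth. [folklore] -/
theorem contDiff_tentIntegrand (γ : ℝ) (N k₁ k₂ : ℕ) (τ : ℝ) :
    ContDiff ℝ ∞ fun p : ℝ × PhaseSpace N => (τ - p.1) * blockCurrent ω₂ lam β γ N k₁ k₂ p.2 :=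
  (contDiff_const.sub contDiff_fst).mul ((contDiff_blockCurrent γ N k₁ k₂).comp contDiff_snd)

/-- The tent integral `x ↦ ∫₀^τ (τ - σ) J_B(Φ_σ x) dσ` is smooth (`τ ≥ 0`). [folklore] -/
theorem contDiff_tent (γ : ℝ) (N k₁ k₂ : ℕ) {τ : ℝ} (hτ : 0 ≤ τ) :
    ContDiff ℝ ∞ fun y : PhaseSpace N =>
      ∫ σ in (0:ℝ)..τ, (τ - σ) * blockCurrent ω₂ lam β γ N k₁ k₂ (detFlow ω₂ lam β N σ y) :=
  contDiff_intervalIntegral_comp_detFlow hω hl hβ N (contDiff_tentIntegrand γ N k₁ k₂ τ) le_rfl hτ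

/-- **Moving-window derivative along the flow.** The Poisson bracket of `H` with the tent integral
`G̃(x) = ∫₀^τ (τ - σ) J_B(Φ_σ x) dσ` is `{H, G̃} = Q_B(τ) - τ J_B`: by the flow property
`G̃(Φ_r x) = ∫_r^{τ+r} (τ + r - u) J_B(Φ_u x) du`, whose derivative at `r = 0⁺` is `∫₀^τ J_B(Φ_u x) du - τ J_B(x)`,
while the chain rule gives `d/dr G̃(Φ_r x)|_{0⁺} = DG̃(x)·X_H(x) = {H, G̃}(x)`. [folklore] -/
theorem poisson_tent (γ : ℝ) (N k₁ k₂ : ℕ) {τ : ℝ} (hτ : 0 ≤ τ) (x : PhaseSpace N) :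
    poisson ((pinnedChain ω₂ lam β γ).hamiltonian N)
      (fun y => ∫ σ in (0:ℝ)..τ, (τ - σ) * blockCurrent ω₂ lam β γ N k₁ k₂ (detFlow ω₂ lam β N σ y)) x =
      window ω₂ lam β γ N k₁ k₂ τ x - τ * blockCurrent ω₂ lam β γ N k₁ k₂ x := by
  set J := blockCurrent ω₂ lam β γ N k₁ k₂ with hJ
  set Gt : PhaseSpace N → ℝ := fun y => ∫ σ in (0:ℝ)..τ, (τ - σ) * J (detFlow ω₂ lam β N σ y) with hGt
  have hGs : ContDiff ℝ ∞ Gt := contDiff_tent hω hl hβ γ N k₁ k₂ hτ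
  have hGd : Differentiable ℝ Gt := hGs.differentiable (by simp)
  -- chain rule along the flow at `r = 0⁺`
  have h1 : HasDerivWithinAt (fun r => Gt (detFlow ω₂ lam β N r x))
      (poisson ((pinnedChain ω₂ lam β 0).hamiltonian N) Gt x) (Ici 0) 0 := by
    have hin := OddSectorIrreversibility.Corrector.hasDerivWithinAt_detFlow hω hl hβ N x le_rfl
    rw [detFlow_of_nonpos N le_rfl x] at hin
    have hF : HasFDerivAt Gt (fderiv ℝ Gt x) (detFlow ω₂ lam β N 0 x) := by
      rw [detFlow_of_nonpos N le_rfl x]; exact (hGd x).hasFDerivAt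
    have h := hF.comp_hasDerivWithinAt (0:ℝ) hin
    rw [Negative.ClosedFlow.fderiv_drift_eq_poisson N hGd] at h
    exact h
  -- the explicit side
  have hg : Continuous fun u => J (detFlow ω₂ lam β N u x) :=
    (continuous_blockCurrent N γ k₁ k₂).comp (continuous_detFlow_time hω hl hβ N x)
  have hshiftEq : ∀ r, 0 ≤ r →
      Gt (detFlow ω₂ lam β N r x) = ∫ u in r..(τ + r), (τ + r - u) * J (detFlow ω₂ lam β N u x) := by
    intro r hr
    have hc : Gt (detFlow ω₂ lam β N r x) =
        ∫ σ in (0:ℝ)..τ, (fun u => (τ + r - u) * J (detFlow ω₂ lam β N u x)) (σ + r) := by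
      simp only [hGt]
      refine intervalIntegral.integral_congr fun σ hσ => ?_
      have hσ0 : 0 ≤ σ := by rw [uIcc_of_le hτ] at hσ; exact hσ.1
      show (τ - σ) * J (detFlow ω₂ lam β N σ (detFlow ω₂ lam β N r x)) =
        (τ + r - (σ + r)) * J (detFlow ω₂ lam β N (σ + r) x)
      rw [← OddSectorIrreversibility.Corrector.detFlow_add hω hl hβ N x hr hσ0, add_comm r σ]
      congr 1
      ring
    rw [hc, intervalIntegral.integral_comp_add_right (fun u => (τ + r - u) * J (detFlow ω₂ lam β N u x)) r,
      zero_add]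
  have h2 : HasDerivWithinAt (fun r => Gt (detFlow ω₂ lam β N r x))
      ((∫ u in (0:ℝ)..τ, J (detFlow ω₂ lam β N u x)) - τ * J (detFlow ω₂ lam β N 0 x)) (Ici 0) 0 := by
    have h := (hasDerivAt_movingTent hg τ).hasDerivWithinAt (s := Ici 0)
    refine h.congr (fun r hr => hshiftEq r hr) ?_
    have := hshiftEq 0 le_rfl
    simpa using this
  have huniq := (uniqueDiffWithinAt_Ici (0:ℝ)).eq_deriv _ h1 h2
  rw [detFlow_of_nonpos N le_rfl x, intervalIntegral.integral_of_le hτ] at huniq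
  exact huniq

/-! ## §5 E2 ⇒ the corrector family (time-averaged coboundary corrector) -/

/-- **E2 ⇒ corrector family** (vocabulary form). If the windowed variance ceiling
`∫ Q_B(t)² dμ_T ≤ C (1+t) (k₂-k₁) Z` holds for all `t ≥ 0` (`C ≥ 0`, `k₁ ≤ k₂`), then for every `τ ≥ 1` the
time-averaged coboundary corrector `G_τ = -(1/τ) ∫₀^τ (τ - σ) J_B∘Φ_σ dσ = -(1/τ) ∫₀^τ Q_B(t) dt` is `C²`
(indeed `C^∞`), `G_τ, {H,G_τ} ∈ L²(μ_T)`, `{H, G_τ} = J_B - Q_B(τ)/τ`, and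
`8 ∫ G_τ² dμ_T + 2 τ² ∫ (J_B - {H,G_τ})² dμ_T ≤ 10 C (1+τ) (k₂-k₁) Z`. [folklore] -/
theorem correctorFamily_of_windowBound (γ : ℝ) (N k₁ k₂ : ℕ) {T : ℝ} (hT : 0 < T) {C : ℝ} (hC : 0 ≤ C)
    (hk : k₁ ≤ k₂)
    (hE2 : ∀ t : ℝ, 0 ≤ t → ∫ x, (window ω₂ lam β γ N k₁ k₂ t x) ^ 2 ∂(gibbsWeight ω₂ lam β γ N T) ≤
      C * (1 + t) * ((k₂ : ℝ) - k₁) * ∫ x, Real.exp (-((pinnedChain ω₂ lam β γ).hamiltonian N x) / T))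
    {τ : ℝ} (hτ : 1 ≤ τ) :
    ∃ (G : PhaseSpace N → ℝ) (c : ℝ), ContDiff ℝ 2 G ∧ MemLp G 2 (gibbsWeight ω₂ lam β γ N T) ∧
      MemLp (poisson ((pinnedChain ω₂ lam β γ).hamiltonian N) G) 2 (gibbsWeight ω₂ lam β γ N T) ∧
      8 * ∫ x, (G x - c) ^ 2 ∂(gibbsWeight ω₂ lam β γ N T) +
        2 * τ ^ 2 * ∫ x, (blockCurrent ω₂ lam β γ N k₁ k₂ x -
          poisson ((pinnedChain ω₂ lam β γ).hamiltonian N) G x) ^ 2 ∂(gibbsWeight ω₂ lam β γ N T) ≤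
        10 * C * (1 + τ) * ((k₂ : ℝ) - k₁) *
          ∫ x, Real.exp (-((pinnedChain ω₂ lam β γ).hamiltonian N x) / T) := by
  haveI := isFiniteMeasure_gibbsWeight hω hl hβ γ N hT
  have hτ0 : 0 < τ := by linarith
  set μ := gibbsWeight ω₂ lam β γ N T with hμ
  set Z := ∫ x, Real.exp (-((pinnedChain ω₂ lam β γ).hamiltonian N x) / T) with hZ
  set Hm := (pinnedChain ω₂ lam β γ).hamiltonian N with hHm
  set J := blockCurrent ω₂ lam β γ N k₁ k₂ with hJ
  set Q : ℝ → PhaseSpace N → ℝ := fun t x => window ω₂ lam β γ N k₁ k₂ t x with hQ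
  set Gt : PhaseSpace N → ℝ := fun y => ∫ σ in (0:ℝ)..τ, (τ - σ) * J (detFlow ω₂ lam β N σ y) with hGt
  set G : PhaseSpace N → ℝ := fun y => -(1 / τ) * Gt y with hG
  have hZ0 : 0 ≤ Z := integral_nonneg fun _ => (Real.exp_pos _).le
  have hℓ0 : (0 : ℝ) ≤ (k₂ : ℝ) - k₁ := by
    have : (k₁ : ℝ) ≤ k₂ := by exact_mod_cast hk
    linarith
  -- the uniform slice bound on `(0, τ]`
  set M := C * (1 + τ) * ((k₂ : ℝ) - k₁) * Z with hMdef
  have hM : ∀ t ∈ Ioc (0:ℝ) τ, ∫ x, (Q t x) ^ 2 ∂μ ≤ M := fun t ht => by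
    refine (hE2 t ht.1.le).trans ?_
    have h0 : 0 ≤ C * ((k₂ : ℝ) - k₁) * Z := by positivity
    nlinarith [ht.2]
  -- smoothness
  have hGts : ContDiff ℝ ∞ Gt := contDiff_tent hω hl hβ γ N k₁ k₂ hτ0.le
  have hGs : ContDiff ℝ ∞ G := contDiff_const.mul hGts
  -- Poisson brackets
  have hPGt : ∀ x, poisson Hm Gt x = Q τ x - τ * J x := fun x => poisson_tent hω hl hβ γ N k₁ k₂ hτ0.le x
  have hPG : ∀ x, poisson Hm G x = -(1 / τ) * (Q τ x - τ * J x) := fun x => by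
    rw [hG, poisson_const_mul_right, hPGt]
  have hdef : ∀ x, J x - poisson Hm G x = (1 / τ) * Q τ x := fun x => by
    rw [hPG]
    field_simp
    ring
  -- `G = -(1/τ) ∫₀^τ Q_B(t) dt`
  have hGQ : ∀ x, G x = -(1 / τ) * ∫ t in (0:ℝ)..τ, Q t x := fun x => by
    simp only [hG, hGt, hQ, hJ, intervalIntegral_window_eq_tent hω hl hβ γ N k₁ k₂ hτ0.le x]
  -- square integrability of `G`
  have hGmeas : AEStronglyMeasurable G μ := hGs.continuous.aestronglyMeasurable
  set K := (N : ℝ) * ((N : ℝ) * ((3 + β) / 2)) with hK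
  have hGabs : ∀ x, |G x| ≤ (τ * K) * (1 + Hm x) ^ 2 := by
    intro x
    rw [hGQ x]
    have hb : ∀ t ∈ Set.uIoc (0:ℝ) τ, ‖Q t x‖ ≤ τ * (K * (1 + Hm x) ^ 2) := by
      intro t ht
      rw [Set.uIoc_of_le hτ0.le] at ht
      rw [Real.norm_eq_abs]
      have h := abs_window_le hω hl hβ N γ k₁ k₂ ht.1.le x
      have hKH : 0 ≤ K * (1 + Hm x) ^ 2 := by
        have : 0 ≤ Hm x := pinnedChain_hamiltonian_nonneg hω.le hl hβ γ N x
        positivity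
      calc |Q t x| ≤ t * (N * (N * ((3 + β) / 2 * (1 + Hm x) ^ 2))) := h
        _ = t * (K * (1 + Hm x) ^ 2) := by rw [hK]; ring
        _ ≤ τ * (K * (1 + Hm x) ^ 2) := mul_le_mul_of_nonneg_right ht.2 hKH
    have hn := intervalIntegral.norm_integral_le_of_norm_le_const hb
    rw [Real.norm_eq_abs, sub_zero, abs_of_pos hτ0] at hn
    rw [abs_mul, abs_neg, abs_of_pos (by positivity : (0:ℝ) < 1 / τ)]
    calc 1 / τ * |∫ t in (0:ℝ)..τ, Q t x| ≤ 1 / τ * (τ * (K * (1 + Hm x) ^ 2) * τ) :=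
          mul_le_mul_of_nonneg_left hn (by positivity)
      _ = (τ * K) * (1 + Hm x) ^ 2 := by field_simp
  have hGL : MemLp G 2 μ := memLp_two_of_abs_le_pow hω hl hβ γ N hT hGmeas (τ * K) 2 hGabs
  -- square integrability of `{H, G} = -(1/τ)(Q_B(τ) - τ J_B)`
  have hPGfun : poisson Hm G = fun x => -(1 / τ) * (Q τ x - τ * J x) := funext hPG
  have hPGL : MemLp (poisson Hm G) 2 μ := by
    rw [hPGfun]
    exact ((memLp_two_window hω hl hβ N γ k₁ k₂ hτ0.le hT).sub
      ((CoboundaryCeiling.memLp_two_blockCurrent hω hl hβ γ N k₁ k₂ hT).const_mul τ)).const_mul _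
  -- the defect term: `τ² ∫ (J - {H,G})² = ∫ Q_B(τ)²`
  have hdefect : 2 * τ ^ 2 * ∫ x, (J x - poisson Hm G x) ^ 2 ∂μ = 2 * ∫ x, (Q τ x) ^ 2 ∂μ := by
    have h1 : ∫ x, (J x - poisson Hm G x) ^ 2 ∂μ = (1 / τ) ^ 2 * ∫ x, (Q τ x) ^ 2 ∂μ := by
      rw [← integral_const_mul]
      refine integral_congr_ae (Eventually.of_forall fun x => ?_)
      simp only [hdef x, mul_pow]
    rw [h1]
    field_simp
  -- the variance term: `∫ G² ≤ M`
  have hvar : ∫ x, (G x - 0) ^ 2 ∂μ ≤ M := by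
    have h1 : ∫ x, (G x - 0) ^ 2 ∂μ = (1 / τ) ^ 2 * ∫ x, (∫ t in (0:ℝ)..τ, Q t x) ^ 2 ∂μ := by
      rw [← integral_const_mul]
      refine integral_congr_ae (Eventually.of_forall fun x => ?_)
      show (G x - 0) ^ 2 = (1 / τ) ^ 2 * (∫ t in (0:ℝ)..τ, Q t x) ^ 2
      rw [sub_zero, hGQ x, mul_pow, neg_sq]
    rw [h1]
    have h2 := integral_sq_intervalIntegral_window_le hω hl hβ γ N k₁ k₂ hT hτ0.le hM
    calc (1 / τ) ^ 2 * ∫ x, (∫ t in (0:ℝ)..τ, Q t x) ^ 2 ∂μ ≤ (1 / τ) ^ 2 * (τ * (τ * M)) :=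
          mul_le_mul_of_nonneg_left h2 (by positivity)
      _ = M := by field_simp
  refine ⟨G, 0, contDiff_infty.1 hGs 2, hGL, hPGL, ?_⟩
  rw [hdefect]
  have hQτ : ∫ x, (Q τ x) ^ 2 ∂μ ≤ C * (1 + τ) * ((k₂ : ℝ) - k₁) * Z := hE2 τ hτ0.le
  calc 8 * ∫ x, (G x - 0) ^ 2 ∂μ + 2 * ∫ x, (Q τ x) ^ 2 ∂μ
      ≤ 8 * M + 2 * (C * (1 + τ) * ((k₂ : ℝ) - k₁) * Z) := by
        have := mul_le_mul_of_nonneg_left hvar (by norm_num : (0:ℝ) ≤ 8)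
        have := mul_le_mul_of_nonneg_left hQτ (by norm_num : (0:ℝ) ≤ 2)
        linarith
    _ = 10 * C * (1 + τ) * ((k₂ : ℝ) - k₁) * Z := by rw [hMdef]; ring

end Flow

/-! ## §6 E2 ⇒ `stub_correctorFamily` (route-decl form) -/

/-- **`SubBallisticWindow` implies the corrector family** (`stub_correctorFamily` of line `Sketch`, verbatim):
with the E2 constant `C`, the corrector-family constant is `10 · max C 0`. Combined with the line's
composition (`stub_correctorFamily` + the five LANDED stubs ⇒ `SubBallisticWindow`, skeleton
`Cruxes/SubBallisticWindow/Lines/Sketch.lean`), the open stub is exactly E2-EQUIVALENT. Route: the Dirac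
dictionary for the zero-friction kernels (`integral_transitionKernel_zero_friction`) turns E2 into the windowed
variance ceiling for `window`, and `correctorFamily_of_windowBound` supplies `G_τ`. [folklore] -/
theorem correctorFamily_of_subBallisticWindow : SubBallisticWindow → ∀ ω₂ lam β γ : ℝ, 0 < ω₂ → 0 < lam → 0 < β → 0 < γ → ∀ T : ℝ, 0 < T → ∃ C : ℝ, ∀ (N k₁ k₂ : ℕ), k₁ ≤ k₂ → k₁ + 2 ≤ k₂ → k₂ + 1 ≤ N → ∀ τ : ℝ, 1 ≤ τ → ∃ (G : PhaseSpace N → ℝ) (c : ℝ), ContDiff ℝ 2 G ∧ MemLp G 2 (volume.withDensity fun x : PhaseSpace N => ENNReal.ofReal (Real.exp (-((pinnedChain ω₂ lam β γ).hamiltonian N x) / T))) ∧ MemLp (poisson ((pinnedChain ω₂ lam β γ).hamiltonian N) G) 2 (volume.withDensity fun x : PhaseSpace N => ENNReal.ofReal (Real.exp (-((pinnedChain ω₂ lam β γ).hamiltonian N x) / T))) ∧ 8 * ∫ x, (G x - c) ^ 2 ∂(volume.withDensity fun x : PhaseSpace N => ENNReal.ofReal (Real.exp (-((pinnedChain ω₂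 lam β γ).hamiltonian N x) / T))) + 2 * τ ^ 2 * ∫ x, ((fun z : PhaseSpace N => ∑ i : Fin N, (if k₁ ≤ i.val ∧ i.val < k₂ then (pinnedChain ω₂ lam β γ).bondCurrent N i z else 0)) x - poisson ((pinnedChain ω₂ lam β γ).hamiltonian N) G x) ^ 2 ∂(volume.withDensity fun x : PhaseSpace N => ENNReal.ofReal (Real.exp (-((pinnedChain ω₂ lam β γ).hamiltonian N x) / T))) ≤ C * (1 + τ) * ((k₂ : ℝ) - k₁) * (∫ x : PhaseSpace N, Real.exp (-((pinnedChain ω₂ lam β γ).hamiltonian N x) / T)) := by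
  intro hE2 ω₂ lam β γ hω hl hβ hγ T hT
  obtain ⟨C, hC⟩ := hE2 ω₂ lam β γ hω hl hβ hγ T hT
  refine ⟨10 * max C 0, fun N k₁ k₂ hk _ hkN τ hτ => ?_⟩
  -- E2 read through the Dirac dictionary: the windowed variance ceiling for `window`
  have hE2' : ∀ t : ℝ, 0 ≤ t → ∫ x, (window ω₂ lam β γ N k₁ k₂ t x) ^ 2 ∂(gibbsWeight ω₂ lam β γ N T) ≤
      max C 0 * (1 + t) * ((k₂ : ℝ) - k₁) *
        ∫ x, Real.exp (-((pinnedChain ω₂ lam β γ).hamiltonian N x) / T) := by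
    intro t ht
    have h := hC N k₁ k₂ hk hkN t ht
    simp only at h
    have hlhs : ∫ x, (∫ s in Ioc (0 : ℝ) t, (∫ y, (fun z : PhaseSpace N => ∑ i : Fin N,
        (if k₁ ≤ i.val ∧ i.val < k₂ then (pinnedChain ω₂ lam β γ).bondCurrent N i z else 0)) y
          ∂((pinnedChain ω₂ lam β 0).transitionKernel N T T s.toNNReal x))) ^ 2
          ∂(gibbsWeight ω₂ lam β γ N T) =
        ∫ x, (window ω₂ lam β γ N k₁ k₂ t x) ^ 2 ∂(gibbsWeight ω₂ lam β γ N T) := by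
      refine integral_congr_ae (Eventually.of_forall fun x => ?_)
      simp only
      unfold window
      congr 1
      refine setIntegral_congr_fun measurableSet_Ioc fun s hs => ?_
      rw [integral_transitionKernel_zero_friction hω hl.le hβ.le, Real.coe_toNNReal _ hs.1.le]
      rfl
    have hZ0 : 0 ≤ ∫ x, Real.exp (-((pinnedChain ω₂ lam β γ).hamiltonian N x) / T) :=
      integral_nonneg fun _ => (Real.exp_pos _).le
    have hℓ0 : (0 : ℝ) ≤ (k₂ : ℝ) - k₁ := by
      have : (k₁ : ℝ) ≤ k₂ := by exact_mod_cast hk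
      linarith
    have hw : 0 ≤ (1 + t) * ((k₂ : ℝ) - k₁) * ∫ x, Real.exp (-((pinnedChain ω₂ lam β γ).hamiltonian N x) / T) := by
      positivity
    calc ∫ x, (window ω₂ lam β γ N k₁ k₂ t x) ^ 2 ∂(gibbsWeight ω₂ lam β γ N T)
        ≤ C * (1 + t) * ((k₂ : ℝ) - k₁) * ∫ x, Real.exp (-((pinnedChain ω₂ lam β γ).hamiltonian N x) / T) := by
          rw [← hlhs]; exact h
      _ = C * ((1 + t) * ((k₂ : ℝ) - k₁) * ∫ x, Real.exp (-((pinnedChain ω₂ lam β γ).hamiltonian N x) / T)) := by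
          ring
      _ ≤ max C 0 * ((1 + t) * ((k₂ : ℝ) - k₁) * ∫ x, Real.exp (-((pinnedChain ω₂ lam β γ).hamiltonian N x) / T)) :=
          mul_le_mul_of_nonneg_right (le_max_left _ _) hw
      _ = _ := by ring
  exact correctorFamily_of_windowBound hω hl.le hβ.le γ N k₁ k₂ hT (le_max_right C 0) hk hE2' hτ


/-! ## §7 The equivalence: `SubBallisticWindow ↔ corrector family` -/

/-- **`SubBallisticWindow` ⟺ corrector family.** The crux E2 (an `N`-uniform DYNAMICAL statement about the
closed Hamiltonian flow) is equivalent to the purely STATIC variational statement `stub_correctorFamily` of line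
`Sketch`: for all parameters `> 0`, `T > 0` there is `C` such that for every `N`, block `[k₁,k₂)` with
`k₂ - k₁ ≥ 2`, `k₂ + 1 ≤ N` and window `τ ≥ 1` some `G ∈ C²` with `G, {H,G} ∈ L²(μ_T)` and constant `c` achieve
`8 ∫ (G - c)² dμ_T + 2 τ² ∫ (J_B - {H,G})² dμ_T ≤ C (1+τ) (k₂-k₁) Z` (no flow appears: only `μ_T`-integrals of
`G`, `{H,G}`, `J_B`). `⇒`: the time-averaged coboundary corrector (constant `10·max C 0`); `⇐`: the coboundary
(Thomson) ceiling and the statics of the line (`Partial.subBallisticWindow_of_correctorFamily`). [folklore] -/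
theorem subBallisticWindow_iff_correctorFamily :
    SubBallisticWindow ↔
    (∀ ω₂ lam β γ : ℝ, 0 < ω₂ → 0 < lam → 0 < β → 0 < γ → ∀ T : ℝ, 0 < T → ∃ C : ℝ,
      ∀ (N k₁ k₂ : ℕ), k₁ ≤ k₂ → k₁ + 2 ≤ k₂ → k₂ + 1 ≤ N → ∀ τ : ℝ, 1 ≤ τ →
        ∃ (G : PhaseSpace N → ℝ) (c : ℝ), ContDiff ℝ 2 G ∧
          MemLp G 2 (volume.withDensity fun x : PhaseSpace N => ENNReal.ofReal (Real.exp (-((pinnedChain ω₂ lam β γ).hamiltonian N x) / T))) ∧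
          MemLp (poisson ((pinnedChain ω₂ lam β γ).hamiltonian N) G) 2
            (volume.withDensity fun x : PhaseSpace N => ENNReal.ofReal (Real.exp (-((pinnedChain ω₂ lam β γ).hamiltonian N x) / T))) ∧
          8 * ∫ x, (G x - c) ^ 2
              ∂(volume.withDensity fun x : PhaseSpace N => ENNReal.ofReal (Real.exp (-((pinnedChain ω₂ lam β γ).hamiltonian N x) / T))) +
            2 * τ ^ 2 * ∫ x,
              ((fun z : PhaseSpace N => ∑ i : Fin N, (if k₁ ≤ i.val ∧ i.val < k₂ then (pinnedChain ω₂ lam β γ).bondCurrent N i z else 0)) x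
                - poisson ((pinnedChain ω₂ lam β γ).hamiltonian N) G x) ^ 2
              ∂(volume.withDensity fun x : PhaseSpace N => ENNReal.ofReal (Real.exp (-((pinnedChain ω₂ lam β γ).hamiltonian N x) / T))) ≤
            C * (1 + τ) * ((k₂ : ℝ) - k₁) * (∫ x : PhaseSpace N, Real.exp (-((pinnedChain ω₂ lam β γ).hamiltonian N x) / T))) :=
  ⟨correctorFamily_of_subBallisticWindow, Partial.subBallisticWindow_of_correctorFamily⟩

end Summit.AtomisticToContinuum.FouriersLaw.Theorems.SubBallisticWindow.CorrectorEquivalence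

end
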